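import Summits.Ventures.LatticeQCDFlow.Scaling.StarSyncIdleBracket

/-!
HONEST FRAMING: exact (Metropolis-corrected) sampling algorithms for lattice gauge theory; figures
of merit are autocorrelation/cost numbers at stated couplings and volumes; no continuum-physics
claim.

# BooleanTwoLevelCertificate — THE FIRST CLOSED REFRESH-CYCLE CERTIFICATE: FOR THE TWO-LEVEL BOOLEAN STAR (`K = 1`, IDENTITY MAP, IDLE COLD LEVEL,
# EXACT HOT REDRAWS, ONE-SIDED DOMINATION `p·μ_1 ≤ μ_0`) AN EXPLICIT RATIONAL SUPERSOLUTION `F` CONTRACTS BY `ρ = p·t/(2t+h)` PER CYCLE, SO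
# `t_mix(ε) ≤ ⌈(4(2t+h)/(p·t·h))·log((e+1)/ε)⌉`, `h = (1−t)w_0` (lean-2 GEN-32, ours)

Venture-side (OURS).  Cell `lqcd-flow` (pub-lqcd), unit `pub-lqcd-lean-2-g32`, 2026-08-29.  Chapter S, file 3: the certificate route `StarSyncCoupling` → `RedrawCycleCoalescence` →
`StarCycleCertificateLaw` → `StarCycleSupersolution` → `StarSyncIdleBracket` run END TO END on its smallest instance, the sanity case (1) of
`lean-2/MEMO-gen31-coupling-certificate.md` §9a.  Contents `Bool`, hub `0` with hot law `μ_0` redrawn exactly at weight `w_0`, one cold level with law `μ_1`, idle between swaps,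
`m ≥ 1` entries all on the edge `(0,1)` through the identity map, Metropolis swaps at total rate `t`, and the one-sided domination `p·μ_1(u) ≤ μ_0(u)`.  Under the synchronous coupling,
after a shared redraw to `v` the copy whose cold level holds `v` is frozen and the other oscillates between `(v, v̄)` and `(v̄, v)` with acceptances `A(v)` (forward) and `A(v̄)`
(backward), `A(v) = min{1, μ_0(v̄)μ_1(v)/(μ_0(v)μ_1(v̄))}`; the killed two-state chain has the explicit value `f(v) = (h + t·A(v̄))/Z`, `g(v) = t·A(v̄)/Z`, `Z = h + t(A(v)+A(v̄))` (`f` at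
"hubs agree, levels differ", `g` at "hubs differ, levels agree"), and `F = 1` on the two crossed pairs is a supersolution there.  The bracket inequalities of `StarSyncIdleBracket`
hold (four of them with equality), and `(R·F)(levels differ) = Σ_v μ_0(v)·f(v) = 1 − t·Σ_v μ_0(v)A(v)/Z ≤ 1 − p·t/(2t+h)` by `μ_0(v)·A(v) ≥ p·μ_1(v)` (domination at `v` or at `v̄`)
and `Z ≤ h + 2t`.  Everything is a hypothesis-equation; no definitions.

## What is proved

* §1 `twoLevelCert_shape_P`, `twoLevelCert_shape_S` (the two exact identities of the killed two-state chain).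
* §2 `twoLevel_kernels_isRowStochastic`, `twoLevel_kernels_detailedBalance` (the redraw and the idle kernel), `twoLevelBool_succ_eq_one`, `twoLevelBool_swap_apply_zero` ∕ `_one`,
  `twoLevelBool_tensorFun`, `twoLevelBool_accept_eq` (`α_r(z) = 1` if `z_0 = z_1`, else `A(z_0)`), `twoLevelBool_A_mem` (`0 ≤ A ≤ 1`), **`twoLevelBool_domination`** (`p·μ_1(v) ≤ μ_0(v)·A(v)`).
* §3 `twoLevelCert_nonneg`, **`twoLevelCert_bracket`** (the bracket inequalities for all sixteen pairs), **`twoLevelCert_redraw`** (`R·F ≤ (1 − p·t/(2t+h))·Ψ`), and the law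
  **`twoLevelBool_mixingTime_le_certificate`**: `t_mix(ε) ≤ ⌈(4/((1−t)w_0·ρ))·log((e+1)/ε)⌉₊`, `ρ = p·t/(2t + (1−t)w_0)` (`0 < t < 1`, `w_0 > 0`, `0 < p`).

Reading (no numerics implied): the same order as `TwoLevelCycleLaw` (R4: `⌈(2(2t+h)/(pth))·log(3/ε)⌉` on any finite `S`), a factor `2` weaker in the constant; the point is the
route, not the rate — for `K ≥ 2` only the function `F` changes.  For `q ≥ 3` contents the synchronous coupling is NOT order-sharp already at `K = 1` (a fresh hub content of
intermediate weight traps the two copies in opposite phases; seat memo GEN-32), which is why this file is Boolean.  NOT CLAIMED: anything for `K ≥ 2`; anything measured.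
Literature grade (cell rule): OWN, elementary; nothing cited as a fact; no new bib keys.
-/

noncomputable section

open Finset Function Matrix
open Literature.Probability.MarkovChains

namespace Summit.Ventures.LatticeQCDFlow.Scaling

/-! ## §1 The killed two-state chain: two exact identities -/

/-- `h + t·(A·g + (1−A)·f) = (t+h)·f` for `f = (h + tA')/Z`, `g = tA'/Z`, `Z = h + tA + tA' ≠ 0`. [ours] -/
theorem twoLevelCert_shape_P {h t A A' Z f g : ℝ} (hZ : Z = h + t * A + t * A') (hZ0 : Z ≠ 0) (hf : f = (h + t * A') / Z) (hg : g = t * A' / Z) :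
    h + t * (A * g + (1 - A) * f) = (t + h) * f := by
  subst hZ
  rw [hf, hg]
  field_simp
  ring

/-- `t·(A'·f + (1−A')·g) = (t+h)·g` for the same `f, g, Z`. [ours] -/
theorem twoLevelCert_shape_S {h t A A' Z f g : ℝ} (hZ : Z = h + t * A + t * A') (hZ0 : Z ≠ 0) (hf : f = (h + t * A') / Z) (hg : g = t * A' / Z) :
    t * (A' * f + (1 - A') * g) = (t + h) * g := by
  subst hZ
  rw [hf, hg]
  field_simp
  ring

/-! ## §2 The two-level Boolean star: kernels, swap, acceptances, domination -/

section TwoLevel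
variable {m : ℕ} {μ : Fin 2 → Bool → ℝ} {M : Fin 2 → Bool → Bool → ℝ} {w : Fin 2 → ℝ} {t : ℝ}
variable (κ : Fin m → Fin 1) (φ : Fin m → Bool ≃ Bool)

/-- The exact redraw at the hub and the idle kernel at the cold level are row-stochastic. [ours] -/
theorem twoLevel_kernels_isRowStochastic (hμ : ∀ k x, 0 < μ k x) (hμ1 : ∀ k, ∑ u, μ k u = 1) (hM0 : ∀ u v, M 0 u v = μ 0 v)
    (hidle : ∀ i : Fin 1, ∀ u v, M i.succ u v = if v = u then 1 else 0) (k : Fin 2) : IsRowStochastic (M k) := by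
  cases k using Fin.cases with
  | zero => exact ⟨fun u v => by rw [hM0]; exact (hμ 0 v).le, fun u => by simp_rw [hM0]; exact hμ1 0⟩
  | succ i =>
    refine ⟨fun u v => by rw [hidle]; split_ifs <;> norm_num, fun u => ?_⟩
    simp_rw [hidle i]
    rw [Finset.sum_ite_eq' univ u, if_pos (mem_univ _)]

/-- The exact redraw is `μ_0`-reversible and the idle kernel is `μ_1`-reversible. [ours] -/
theorem twoLevel_kernels_detailedBalance (hM0 : ∀ u v, M 0 u v = μ 0 v) (hidle : ∀ i : Fin 1, ∀ u v, M i.succ u v = if v = u then 1 else 0)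
    (k : Fin 2) : DetailedBalance (μ k) (M k) := by
  intro u v
  cases k using Fin.cases with
  | zero => rw [hM0, hM0, mul_comm]
  | succ i =>
    rw [hidle, hidle]
    by_cases huv : u = v
    · subst huv; rfl
    · rw [if_neg (Ne.symm huv), if_neg huv, mul_zero, mul_zero]

omit φ in
/-- With one cold level every entry sits on the edge `(0,1)`. [ours] -/
theorem twoLevelBool_succ_eq_one (r : Fin m) : (κ r).succ = 1 := by
  rw [Subsingleton.elim (κ r) 0]; rfl

/-- The identity-map swap exchanges the two levels: new hub content = old cold content. [ours] -/
theorem twoLevelBool_swap_apply_zero (hφ : ∀ r, φ r = Equiv.refl Bool) (r : Fin m) (z : Fin 2 → Bool) :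
    edgeFlowSwap (φ r) 0 (κ r).succ z 0 = z 1 := by
  rw [twoLevelBool_succ_eq_one κ r, edgeFlowSwap_fst (φ r) (show (0 : Fin 2) ≠ 1 by decide), hφ]; rfl

/-- The identity-map swap exchanges the two levels: new cold content = old hub content. [ours] -/
theorem twoLevelBool_swap_apply_one (hφ : ∀ r, φ r = Equiv.refl Bool) (r : Fin m) (z : Fin 2 → Bool) :
    edgeFlowSwap (φ r) 0 (κ r).succ z 1 = z 0 := by
  rw [twoLevelBool_succ_eq_one κ r, edgeFlowSwap_snd, hφ]; rfl

omit κ φ in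
/-- `π̃(z) = μ_0(z_0)·μ_1(z_1)`. [ours] -/
theorem twoLevelBool_tensorFun (z : Fin 2 → Bool) : tensorFun μ z = μ 0 (z 0) * μ 1 (z 1) := by
  unfold tensorFun; rw [Fin.prod_univ_two]

/-- **The acceptances:** `α_r(z) = 1` when `z_0 = z_1` (the swap is then the identity), and `α_r(z) = A(z_0)` otherwise, where
`A(v) = min{1, μ_0(v̄)μ_1(v)/(μ_0(v)μ_1(v̄))}` is the acceptance of moving a hub content `v` into a cold level holding `v̄`. [ours] -/
theorem twoLevelBool_accept_eq (hφ : ∀ r, φ r = Equiv.refl Bool) (hμ : ∀ k x, 0 < μ k x)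
    {A : Bool → ℝ} (hA : ∀ v, A v = min 1 (μ 0 (!v) * μ 1 v / (μ 0 v * μ 1 (!v))))
    {α : Fin m → (Fin 2 → Bool) → ℝ} (hα : ∀ r z, α r z = min 1 (tensorFun μ (edgeFlowSwap (φ r) 0 (κ r).succ z) / tensorFun μ z))
    (r : Fin m) (z : Fin 2 → Bool) : α r z = if z 0 = z 1 then 1 else A (z 0) := by
  rw [hα, twoLevelBool_tensorFun, twoLevelBool_tensorFun, twoLevelBool_swap_apply_zero κ φ hφ, twoLevelBool_swap_apply_one κ φ hφ]
  by_cases h01 : z 0 = z 1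
  · rw [if_pos h01, h01, mul_comm, div_self (mul_pos (hμ 1 _) (hμ 0 _)).ne', min_self]
  · rw [if_neg h01, hA]
    have h1 : z 1 = !(z 0) := Bool.eq_not_iff.mpr (Ne.symm h01)
    rw [h1, mul_comm (μ 0 (!z 0))]

omit κ φ in
/-- `0 ≤ A(v) ≤ 1`. [ours] -/
theorem twoLevelBool_A_mem (hμ : ∀ k x, 0 < μ k x) {A : Bool → ℝ} (hA : ∀ v, A v = min 1 (μ 0 (!v) * μ 1 v / (μ 0 v * μ 1 (!v)))) (v : Bool) :
    0 ≤ A v ∧ A v ≤ 1 := by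
  rw [hA]
  exact ⟨le_min zero_le_one (div_nonneg (mul_nonneg (hμ 0 _).le (hμ 1 _).le) (mul_nonneg (hμ 0 _).le (hμ 1 _).le)), min_le_left _ _⟩

omit κ φ in
/-- **Domination at `v` or at `v̄`:** `p·μ_1(u) ≤ μ_0(u)` for both contents gives `p·μ_1(v) ≤ μ_0(v)·A(v)`. [ours] -/
theorem twoLevelBool_domination (hμ : ∀ k x, 0 < μ k x) {A : Bool → ℝ} (hA : ∀ v, A v = min 1 (μ 0 (!v) * μ 1 v / (μ 0 v * μ 1 (!v))))
    {p : ℝ} (hdom : ∀ u, p * μ 1 u ≤ μ 0 u) (v : Bool) : p * μ 1 v ≤ μ 0 v * A v := by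
  rw [hA, mul_min_of_nonneg _ _ (hμ 0 v).le, mul_one]
  refine le_min (hdom v) ?_
  have hv0 : μ 0 v ≠ 0 := (hμ 0 v).ne'
  have hv1 : μ 1 (!v) ≠ 0 := (hμ 1 (!v)).ne'
  have h1 : μ 0 v * (μ 0 (!v) * μ 1 v / (μ 0 v * μ 1 (!v))) = μ 0 (!v) * μ 1 v / μ 1 (!v) := by
    field_simp
  rw [h1, le_div_iff₀ (hμ 1 _)]
  calc p * μ 1 v * μ 1 (!v) = (p * μ 1 (!v)) * μ 1 v := by ring
    _ ≤ μ 0 (!v) * μ 1 v := mul_le_mul_of_nonneg_right (hdom (!v)) (hμ 1 v).le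

/-! ## §3 The certificate -/

/-- `F ≥ 0`. [ours] -/
theorem twoLevelCert_nonneg (ht0 : 0 ≤ t) {h : ℝ} (hh0 : 0 < h) {A : Bool → ℝ} (hA0 : ∀ v, 0 ≤ A v)
    {Z : ℝ} (hZ : Z = h + t * A true + t * A false) {ff gg : Bool → ℝ} (hff : ∀ v, ff v = (h + t * A (!v)) / Z) (hgg : ∀ v, gg v = t * A (!v) / Z)
    {F : (Fin 2 → Bool) × (Fin 2 → Bool) → ℝ}
    (hF : ∀ a, F a = if a.1 1 = a.2 1 then (if a.1 0 = a.2 0 then 0 else gg (a.1 1)) else (if a.1 0 = a.2 0 then ff (a.1 0) else 1))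
    (a : (Fin 2 → Bool) × (Fin 2 → Bool)) : 0 ≤ F a := by
  have hZ0 : 0 < Z := by rw [hZ]; nlinarith [hA0 true, hA0 false]
  have hf0 : ∀ v, 0 ≤ ff v := fun v => by rw [hff]; exact div_nonneg (by nlinarith [hA0 (!v)]) hZ0.le
  have hg0 : ∀ v, 0 ≤ gg v := fun v => by rw [hgg]; exact div_nonneg (by nlinarith [hA0 (!v)]) hZ0.le
  rw [hF]; split_ifs
  · exact le_rfl
  · exact hg0 _
  · exact hf0 _
  · exact zero_le_one

/-- **THE BRACKET INEQUALITIES** of `StarSyncIdleBracket` for the two-level Boolean star, all sixteen pairs: `h·Ψ(a) + Σ_r (t/m)·SW_r(F)(a) ≤ (t+h)·F(a)` with `h = (1−t)w_0`.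
[ours] -/
theorem twoLevelCert_bracket (hm : 1 ≤ m) (hφ : ∀ r, φ r = Equiv.refl Bool) (ht0 : 0 ≤ t) (hw00 : 0 < w 0) (ht1 : t < 1) (hμ : ∀ k x, 0 < μ k x)
    {A : Bool → ℝ} (hA : ∀ v, A v = min 1 (μ 0 (!v) * μ 1 v / (μ 0 v * μ 1 (!v))))
    {α : Fin m → (Fin 2 → Bool) → ℝ} (hα : ∀ r z, α r z = min 1 (tensorFun μ (edgeFlowSwap (φ r) 0 (κ r).succ z) / tensorFun μ z))
    {Z : ℝ} (hZ : Z = (1 - t) * w 0 + t * A true + t * A false) {ff gg : Bool → ℝ}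
    (hff : ∀ v, ff v = ((1 - t) * w 0 + t * A (!v)) / Z) (hgg : ∀ v, gg v = t * A (!v) / Z)
    {F : (Fin 2 → Bool) × (Fin 2 → Bool) → ℝ}
    (hF : ∀ a, F a = if a.1 1 = a.2 1 then (if a.1 0 = a.2 0 then 0 else gg (a.1 1)) else (if a.1 0 = a.2 0 then ff (a.1 0) else 1))
    {Ψ : (Fin 2 → Bool) × (Fin 2 → Bool) → ℝ} (hΨ : ∀ a, Ψ a = if a.1 1 = a.2 1 then 0 else 1)
    (a : (Fin 2 → Bool) × (Fin 2 → Bool)) :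
    (1 - t) * w 0 * Ψ a
        + ∑ r : Fin m, t / m *
          (min (α r a.1) (α r a.2) * F (edgeFlowSwap (φ r) 0 (κ r).succ a.1, edgeFlowSwap (φ r) 0 (κ r).succ a.2)
            + (α r a.1 - min (α r a.1) (α r a.2)) * F (edgeFlowSwap (φ r) 0 (κ r).succ a.1, a.2)
            + (α r a.2 - min (α r a.1) (α r a.2)) * F (a.1, edgeFlowSwap (φ r) 0 (κ r).succ a.2)
            + (1 - α r a.1 - α r a.2 + min (α r a.1) (α r a.2)) * F (a.1, a.2))
      ≤ (t + (1 - t) * w 0) * F a := by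
  obtain ⟨x, y⟩ := a
  set h : ℝ := (1 - t) * w 0 with hh
  have hh0 : 0 < h := mul_pos (by linarith) hw00
  have hAm := twoLevelBool_A_mem hμ hA
  have hZ' : Z = h + t * A true + t * A false := hZ
  have hZ0 : Z ≠ 0 := by rw [hZ']; nlinarith [(hAm true).1, (hAm false).1]
  -- the two identities at both contents (`A (!true)` is `A false` by `rfl`)
  have SPt : h + t * (A true * gg true + (1 - A true) * ff true) = (t + h) * ff true :=
    twoLevelCert_shape_P (A := A true) (A' := A false) hZ' hZ0 (hff true) (hgg true)
  have SPf : h + t * (A false * gg false + (1 - A false) * ff false) = (t + h) * ff false :=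
    twoLevelCert_shape_P (A := A false) (A' := A true) (by rw [hZ']; ring) hZ0 (hff false) (hgg false)
  have SSt : t * (A false * ff true + (1 - A false) * gg true) = (t + h) * gg true :=
    twoLevelCert_shape_S (A := A true) (A' := A false) hZ' hZ0 (hff true) (hgg true)
  have SSf : t * (A true * ff false + (1 - A true) * gg false) = (t + h) * gg false :=
    twoLevelCert_shape_S (A := A false) (A' := A true) (by rw [hZ']; ring) hZ0 (hff false) (hgg false)
  -- the summand does not depend on the entry: rewrite acceptances and swapped components, then sum the constant
  simp only [hF, hΨ, twoLevelBool_accept_eq κ φ hφ hμ hA hα, twoLevelBool_swap_apply_zero κ φ hφ, twoLevelBool_swap_apply_one κ φ hφ]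
  rw [Finset.sum_const, Finset.card_univ, Fintype.card_fin, nsmul_eq_mul]
  have hm0 : (m : ℝ) ≠ 0 := by exact_mod_cast (show m ≠ 0 by omega)
  have hmt : ∀ C : ℝ, (m : ℝ) * (t / m * C) = t * C := fun C => by field_simp
  rw [hmt]
  have hmin1 : ∀ v, min 1 (A v) = A v := fun v => min_eq_right (hAm v).2
  have hmin2 : ∀ v, min (A v) 1 = A v := fun v => min_eq_left (hAm v).2
  have tm1 : t * min (A true) (A false) ≤ t * A true := mul_le_mul_of_nonneg_left (min_le_left _ _) ht0
  have tm2 : t * min (A true) (A false) ≤ t * A false := mul_le_mul_of_nonneg_left (min_le_right _ _) ht0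
  have tm3 : t * min (A false) (A true) ≤ t * A false := mul_le_mul_of_nonneg_left (min_le_left _ _) ht0
  have tm4 : t * min (A false) (A true) ≤ t * A true := mul_le_mul_of_nonneg_left (min_le_right _ _) ht0
  -- sixteen pairs
  rcases Bool.eq_false_or_eq_true (x 0) with hx0 | hx0 <;> rcases Bool.eq_false_or_eq_true (x 1) with hx1 | hx1 <;>
    rcases Bool.eq_false_or_eq_true (y 0) with hy0 | hy0 <;> rcases Bool.eq_false_or_eq_true (y 1) with hy1 | hy1 <;>
    simp only [hx0, hx1, hy0, hy1, hmin1, hmin2, min_self, if_true, if_false, Bool.true_eq_false, Bool.false_eq_true,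
      sub_self, zero_mul, mul_zero, mul_one, add_zero, zero_add] <;>
    linarith [SPt, SPf, SSt, SSf, tm1, tm2, tm3, tm4]

/-- **THE CONTRACTION SEEN FROM THE REDRAW:** `(R·F)(a) ≤ (1 − p·t/(2t+h))·Ψ(a)`, by `μ_0(v)·A(v) ≥ p·μ_1(v)` and `Z ≤ h + 2t`. [ours] -/
theorem twoLevelCert_redraw (ht0 : 0 ≤ t) (hw00 : 0 < w 0) (ht1 : t < 1) (hμ : ∀ k x, 0 < μ k x) (hμ1 : ∀ k, ∑ u, μ k u = 1)
    {A : Bool → ℝ} (hA : ∀ v, A v = min 1 (μ 0 (!v) * μ 1 v / (μ 0 v * μ 1 (!v)))) {p : ℝ} (hp0 : 0 ≤ p)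
    (hdom : ∀ u, p * μ 1 u ≤ μ 0 u)
    {Z : ℝ} (hZ : Z = (1 - t) * w 0 + t * A true + t * A false) {ff gg : Bool → ℝ}
    (hff : ∀ v, ff v = ((1 - t) * w 0 + t * A (!v)) / Z)
    {F : (Fin 2 → Bool) × (Fin 2 → Bool) → ℝ}
    (hF : ∀ a, F a = if a.1 1 = a.2 1 then (if a.1 0 = a.2 0 then 0 else gg (a.1 1)) else (if a.1 0 = a.2 0 then ff (a.1 0) else 1))
    {Ψ : (Fin 2 → Bool) × (Fin 2 → Bool) → ℝ} (hΨ : ∀ a, Ψ a = if a.1 1 = a.2 1 then 0 else 1)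
    {R : (Fin 2 → Bool) × (Fin 2 → Bool) → (Fin 2 → Bool) × (Fin 2 → Bool) → ℝ}
    (hR : ∀ a b, R a b = ∑ v : Bool, μ 0 v * (if b.1 = update a.1 0 v ∧ b.2 = update a.2 0 v then (1 : ℝ) else 0))
    (a : (Fin 2 → Bool) × (Fin 2 → Bool)) :
    (Matrix.mulVec (fun a b => R a b) F) a ≤ (1 - p * t / (2 * t + (1 - t) * w 0)) * Ψ a := by
  obtain ⟨x, y⟩ := a
  set h : ℝ := (1 - t) * w 0 with hh
  have hh0 : 0 < h := mul_pos (by linarith) hw00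
  have hAm := twoLevelBool_A_mem hμ hA
  have hZ0 : 0 < Z := by rw [hZ]; nlinarith [(hAm true).1, (hAm false).1]
  rw [starSync_redraw_mulVec_apply hR F (x, y)]
  simp only [hF, hΨ, update_self, update_of_ne (show (1 : Fin 2) ≠ 0 by decide)]
  by_cases hc : x 1 = y 1
  · simp only [hc, if_true, mul_zero, Finset.sum_const_zero, le_refl]
  · simp only [hc, if_false, if_true, mul_one]
    -- `Σ_v μ_0(v)·f(v) = 1 − t·(Σ_v μ_0(v)A(v))/Z ≤ 1 − p·t/(2t+h)`
    rw [Fintype.sum_bool, hff, hff, Bool.not_true, Bool.not_false]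
    have hsum : μ 0 true + μ 0 false = 1 := by have := hμ1 0; rwa [Fintype.sum_bool] at this
    have hd1 := twoLevelBool_domination hμ hA hdom true
    have hd2 := twoLevelBool_domination hμ hA hdom false
    have hp1 : p * (μ 1 true + μ 1 false) = p := by have := hμ1 1; rw [Fintype.sum_bool] at this; rw [this, mul_one]
    have hZle : Z ≤ h + 2 * t := by rw [hZ]; nlinarith [(hAm true).2, (hAm false).2]
    have hden : 0 < 2 * t + h := by linarith
    -- clear denominators
    have e1 : μ 0 true * ((h + t * A false) / Z) + μ 0 false * ((h + t * A true) / Z)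
        = 1 - t * (μ 0 true * A true + μ 0 false * A false) / Z := by
      field_simp
      rw [hZ]
      linear_combination (h + t * A true + t * A false) * hsum
    rw [e1, sub_le_sub_iff_left, div_le_div_iff₀ hden hZ0]
    have hS : p ≤ μ 0 true * A true + μ 0 false * A false := by linarith
    calc p * t * Z ≤ p * t * (h + 2 * t) := mul_le_mul_of_nonneg_left hZle (mul_nonneg hp0 ht0)
      _ = t * p * (2 * t + h) := by ring
      _ ≤ t * (μ 0 true * A true + μ 0 false * A false) * (2 * t + h) :=
          mul_le_mul_of_nonneg_right (mul_le_mul_of_nonneg_left hS ht0) hden.le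

/-- **THE TWO-LEVEL BOOLEAN STAR THROUGH THE CERTIFICATE ROUTE.**  Contents `Bool`, hub `0` redrawn exactly from `μ_0` at weight `w_0 > 0`, one idle cold level with law
`μ_1`, `m ≥ 1` entries on the edge `(0,1)` through the identity map, swap rate `0 < t < 1`, positive laws, and the one-sided domination `p·μ_1(u) ≤ μ_0(u)` (`0 < p`).  Then
**`t_mix(ε) ≤ ⌈(4/((1−t)w_0·ρ))·log((e + 1)/ε)⌉₊` with `ρ = p·t/(2t + (1−t)w_0)`**, i.e. `⌈(4(2t+h)/(p·t·h))·log((e+1)/ε)⌉` with `h = (1−t)w_0`. [ours] -/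
theorem twoLevelBool_mixingTime_le_certificate (hm : 1 ≤ m) (hφ : ∀ r, φ r = Equiv.refl Bool) (ht0 : 0 < t) (ht1 : t < 1)
    (hw0 : ∀ k, 0 ≤ w k) (hw00 : 0 < w 0) (hw1 : ∑ k, w k = 1) (hμ : ∀ k x, 0 < μ k x) (hμ1 : ∀ k, ∑ u, μ k u = 1)
    (hM0 : ∀ u v, M 0 u v = μ 0 v) (hidle : ∀ i : Fin 1, ∀ u v, M i.succ u v = if v = u then 1 else 0)
    {p : ℝ} (hp0 : 0 < p) (hdom : ∀ u, p * μ 1 u ≤ μ 0 u) {ε : ℝ} (hε : 0 < ε) :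
    mixingTime (fun y z : Fin 2 → Bool =>
        t * ptGraphSwap μ (fun r : Fin m => (((0 : Fin 2), (κ r).succ) : Fin 2 × Fin 2)) φ y z
          + (1 - t) * prodKernel w M y z) (tensorFun μ) ε
      ≤ ⌈1 / ((1 - t) * w 0 * (p * t / (2 * t + (1 - t) * w 0)) / 4) * Real.log ((Real.exp 1 * 1 + 1) / ε)⌉₊ := by
  -- the data of the synchronous coupling as hypothesis-equations instantiated by `rfl`
  have hM := twoLevel_kernels_isRowStochastic hμ hμ1 hM0 hidle
  have hMrev := twoLevel_kernels_detailedBalance hM0 hidle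
  set A : Bool → ℝ := fun v => min 1 (μ 0 (!v) * μ 1 v / (μ 0 v * μ 1 (!v))) with hAdef
  have hA : ∀ v, A v = min 1 (μ 0 (!v) * μ 1 v / (μ 0 v * μ 1 (!v))) := fun v => rfl
  set Z : ℝ := (1 - t) * w 0 + t * A true + t * A false with hZ
  set ff : Bool → ℝ := fun v => ((1 - t) * w 0 + t * A (!v)) / Z with hffdef
  set gg : Bool → ℝ := fun v => t * A (!v) / Z with hggdef
  have hff : ∀ v, ff v = ((1 - t) * w 0 + t * A (!v)) / Z := fun v => rfl
  have hgg : ∀ v, gg v = t * A (!v) / Z := fun v => rfl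
  let α : Fin m → (Fin 2 → Bool) → ℝ := fun r z => min 1 (tensorFun μ (edgeFlowSwap (φ r) 0 (κ r).succ z) / tensorFun μ z)
  have hα : ∀ r z, α r z = min 1 (tensorFun μ (edgeFlowSwap (φ r) 0 (κ r).succ z) / tensorFun μ z) := fun r z => rfl
  let Q : (Fin 2 → Bool) × (Fin 2 → Bool) → (Fin 2 → Bool) × (Fin 2 → Bool) → ℝ := fun a b =>
      ∑ r : Fin m, t / m *
        (min (α r a.1) (α r a.2) * (if b.1 = edgeFlowSwap (φ r) 0 (κ r).succ a.1
              ∧ b.2 = edgeFlowSwap (φ r) 0 (κ r).succ a.2 then (1 : ℝ) else 0)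
          + (α r a.1 - min (α r a.1) (α r a.2)) * (if b.1 = edgeFlowSwap (φ r) 0 (κ r).succ a.1 ∧ b.2 = a.2
              then (1 : ℝ) else 0)
          + (α r a.2 - min (α r a.1) (α r a.2)) * (if b.1 = a.1 ∧ b.2 = edgeFlowSwap (φ r) 0 (κ r).succ a.2
              then (1 : ℝ) else 0)
          + (1 - α r a.1 - α r a.2 + min (α r a.1) (α r a.2)) * (if b.1 = a.1 ∧ b.2 = a.2 then (1 : ℝ) else 0))
      + (1 - t) * ∑ k : Fin 2, w k *
        (if a.1 k = a.2 k ∨ k = 0 then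
            ∑ v : Bool, M k (a.1 k) v * (if b.1 = update a.1 k v ∧ b.2 = update a.2 k v then (1 : ℝ) else 0)
          else coordKernel M k a.1 b.1 * coordKernel M k a.2 b.2)
  let R : (Fin 2 → Bool) × (Fin 2 → Bool) → (Fin 2 → Bool) × (Fin 2 → Bool) → ℝ := fun a b =>
      ∑ v : Bool, μ 0 v * (if b.1 = update a.1 0 v ∧ b.2 = update a.2 0 v then (1 : ℝ) else 0)
  let M' : (Fin 2 → Bool) × (Fin 2 → Bool) → (Fin 2 → Bool) × (Fin 2 → Bool) → ℝ := fun a b => Q a b - (1 - t) * w 0 * R a b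
  let ind : (Fin 2 → Bool) × (Fin 2 → Bool) → ℝ := fun a => if a.1 = a.2 then 0 else 1
  let Ψ : (Fin 2 → Bool) × (Fin 2 → Bool) → ℝ := fun a => if a.1 1 = a.2 1 then 0 else 1
  have hΨ : ∀ a, Ψ a = if a.1 1 = a.2 1 then 0 else 1 := fun a => rfl
  let F : (Fin 2 → Bool) × (Fin 2 → Bool) → ℝ := fun a =>
      if a.1 1 = a.2 1 then (if a.1 0 = a.2 0 then 0 else gg (a.1 1)) else (if a.1 0 = a.2 0 then ff (a.1 0) else 1)
  have hF : ∀ a, F a = if a.1 1 = a.2 1 then (if a.1 0 = a.2 0 then 0 else gg (a.1 1)) else (if a.1 0 = a.2 0 then ff (a.1 0) else 1) :=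
    fun a => rfl
  have hAm := twoLevelBool_A_mem hμ hA
  -- the rate
  have hh0 : 0 < (1 - t) * w 0 := mul_pos (by linarith) hw00
  have hp1 : p ≤ 1 := by
    have h1 := hdom true; have h2 := hdom false
    have := hμ1 1; rw [Fintype.sum_bool] at this
    have := hμ1 0; rw [Fintype.sum_bool] at this
    nlinarith
  have hρ0 : 0 < p * t / (2 * t + (1 - t) * w 0) := div_pos (mul_pos hp0 ht0) (by linarith)
  have hρ1 : p * t / (2 * t + (1 - t) * w 0) ≤ 1 := by
    rw [div_le_one (by linarith)]; nlinarith
  refine starCycle_mixingTime_le_of_idle_supersolution κ φ hm ht0.le ht1 hw0 hw00 hw1 hμ hμ1 hM hMrev hM0 hidle hα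
    (Q := Q) (fun a b => rfl) (R := R) (fun a b => rfl) (M' := M') (fun a b => rfl) (ind := ind) (fun a => rfl)
    (Ψ := Ψ) (Ψmax := 1) (ρ := p * t / (2 * t + (1 - t) * w 0)) (fun a => by rw [hΨ]; split_ifs <;> norm_num)
    (fun a => by rw [hΨ]; split_ifs <;> norm_num) (fun a hex => ?_) hρ0 hρ1 (F := F)
    (twoLevelCert_nonneg ht0.le hh0 (fun v => (hAm v).1) hZ hff hgg hF)
    (twoLevelCert_bracket κ φ hm hφ ht0.le hw00 ht1 hμ hA hα hZ hff hgg hF hΨ)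
    (twoLevelCert_redraw ht0.le hw00 ht1 hμ hμ1 hA hp0.le hdom hZ hff hF hΨ (fun a b => rfl)) hε
  -- `Ψ ≥ 1` where the cold level differs
  obtain ⟨i, hi⟩ := hex
  rw [Subsingleton.elim i 0] at hi
  rw [hΨ, if_neg (by exact hi)]

end TwoLevel

end Summit.Ventures.LatticeQCDFlow.Scaling

end
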